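import Literature.AlgebraicGeometry.Resolution.QuasiRegularSequences
import Literature.NumberTheory.DiophantineGeometry.CafureMateraLemma22MultiplicityProofs
import HarnessLib

/-!
# Polynomial bookkeeping for the coordinate lift (homogenisation against a quasi-regular residue family; substitution)

Route `RadicialJung`, crux `CleanModels` (stmt-ResolutionOfSingularities-15917), registered skeleton `Cruxes/CleanModels/Lines/Sketch.lean`
rev 35 (sha16 de44649d8f729c3b), stub 7 `stub_cleanModelsDimGEFour`.  Explicit-unit seat `decomp-res-hand-2` g5 (structural hand); companion of
`RadicialJungCleanModelsNSCoordinateLift.lean` (item (3d) of the repaired Novacoski–Spivakovsky §3.2 combination, g4 memo §2b / §5).  OURS; pure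
commutative algebra over an arbitrary commutative ring, counted 0; nothing here proves resolution of singularities in characteristic `p`.

(`|cons y α| = y + |α|` is the tree's `CafureMateraLemma22.degree_cons`, imported.)
* `coeff_mem_span_sup_of_isQuasiRegular` — **homogenisation step**: if the residues of `w = (w₀, …, w_s)` modulo `I` are a QUASI-REGULAR sequence
  of `R / I` (Matsumura §16, tree `IsQuasiRegular`) and `N ∈ R[T₁, …, T_s]` of total degree `≤ d` has `Σ_α N_α w₀^{d-|α|} w^α ∈ I` (that is,
  `w₀^d · N(w/w₀) ∈ I`), then every coefficient of `N` lies in `(w) + I` — apply quasi-regularity to the form `T₀^d N(T/T₀)` reduced modulo `I`;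
* `exists_decomp_of_coeff_mem_span_sup` — **substitution step**: a polynomial with all coefficients in `(w) + I` is `P₀ + Σ_i w_i U_i` with `P₀`
  having coefficients in `I`.
[cite: Matsumura1987, §16 Definition p. 124 and Thm. 16.2]
-/

noncomputable section

set_option linter.dupNamespace false -- mandated namespace of this single-conjunct summit

open IsLocalRing MvPolynomial
open Literature.AlgebraicGeometry.Resolution

namespace Summit.ResolutionOfSingularities.ResolutionOfSingularities.Theorems.RadicialJung.CleanModels

section Poly

variable {R : Type*} [CommRing R]

/-- **Homogenisation step.** If the residues of `w = (w₀, …, w_s)` modulo `I` form a quasi-regular sequence of `R / I` and a polynomial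
`N ∈ R[T₁, …, T_s]` of total degree `≤ d` satisfies `Σ_α N_α · w₀^{d - |α|} · w^α ∈ I` (i.e. `w₀^d · N(w/w₀) ∈ I`), then every coefficient of `N`
lies in `(w₀, …, w_s) + I`. [cite: Matsumura1987, §16 Definition p. 124] -/
theorem coeff_mem_span_sup_of_isQuasiRegular {s : ℕ} (I : Ideal R) (w : Fin (s + 1) → R)
    (hqr : IsQuasiRegular (fun i => Ideal.Quotient.mk I (w i)))
    (N : MvPolynomial (Fin s) R) (d : ℕ) (hd : N.totalDegree ≤ d)
    (hN : ∑ α ∈ N.support, N.coeff α * (w 0 ^ (d - α.degree) * ∏ l, w l.succ ^ α l) ∈ I) :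
    ∀ α, N.coeff α ∈ Ideal.span (Set.range w) ⊔ I := by
  classical
  intro α
  by_cases hα : α ∈ N.support
  swap
  · rw [MvPolynomial.notMem_support_iff.mp hα]; exact Submodule.zero_mem _
  -- the homogenisation `H` of `N`
  let c : (Fin s →₀ ℕ) → (Fin (s + 1) →₀ ℕ) := fun β => Finsupp.cons (d - β.degree) β
  have hc_inj : ∀ β β', c β = c β' → β = β' := by
    intro β β' h
    have := congrArg Finsupp.tail h
    simpa only [c, Finsupp.tail_cons] using this
  let H : MvPolynomial (Fin (s + 1)) R := ∑ β ∈ N.support, monomial (c β) (N.coeff β)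
  have hdegβ : ∀ β ∈ N.support, β.degree ≤ d := fun β hβ =>
    le_trans (by rw [Finsupp.degree_apply]; exact le_totalDegree hβ) hd
  have hH : H.IsHomogeneous d := by
    refine IsHomogeneous.sum _ _ _ fun β hβ => isHomogeneous_monomial _ ?_
    rw [Literature.NumberTheory.DiophantineGeometry.CafureMateraLemma22.degree_cons, Nat.sub_add_cancel (hdegβ β hβ)]
  have hHcoeff : ∀ β ∈ N.support, H.coeff (c β) = N.coeff β := by
    intro β hβ
    simp only [H, coeff_sum, coeff_monomial]
    rw [Finset.sum_eq_single β]
    · simp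
    · intro β' _ hne
      rw [if_neg]
      exact fun h => hne (hc_inj _ _ h)
    · intro h; exact absurd hβ h
  have hHeval : eval w H = ∑ α ∈ N.support, N.coeff α * (w 0 ^ (d - α.degree) * ∏ l, w l.succ ^ α l) := by
    simp only [H, map_sum, eval_monomial]
    refine Finset.sum_congr rfl fun β _ => ?_
    congr 1
    rw [Finsupp.prod_fintype _ _ (fun i => by simp), Fin.prod_univ_succ]
    simp only [c, Finsupp.cons_zero, Finsupp.cons_succ]
  -- apply quasi-regularity to `H mod I`
  have hmem : eval (fun i => Ideal.Quotient.mk I (w i)) (map (Ideal.Quotient.mk I) H) ∈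
      Ideal.span (Set.range fun i => Ideal.Quotient.mk I (w i)) ^ (d + 1) := by
    have : eval (fun i => Ideal.Quotient.mk I (w i)) (map (Ideal.Quotient.mk I) H) = Ideal.Quotient.mk I (eval w H) := by
      rw [eval_map]
      have h1 := eval₂_comp_left (Ideal.Quotient.mk I) (RingHom.id R) w H
      rw [RingHom.comp_id] at h1
      rw [show (fun i => Ideal.Quotient.mk I (w i)) = (Ideal.Quotient.mk I) ∘ w from rfl, ← h1]
      rfl
    rw [this, hHeval, Ideal.Quotient.eq_zero_iff_mem.mpr hN]
    exact Ideal.zero_mem _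
  have hq := (isQuasiRegular_def _).mp hqr d _ (hH.map _) hmem (c α)
  rw [coeff_map, hHcoeff α hα] at hq
  have hrange : (Set.range fun i => Ideal.Quotient.mk I (w i)) = (Ideal.Quotient.mk I) '' Set.range w := by
    rw [← Set.range_comp]; rfl
  rw [hrange, ← Ideal.map_span, ← Ideal.mem_comap, Ideal.comap_map_of_surjective _ Ideal.Quotient.mk_surjective,
    ← RingHom.ker_eq_comap_bot, Ideal.mk_ker] at hq
  exact hq

/-- **Substitution step.** If every coefficient of `N ∈ R[T_σ]` lies in `(w_i)_i + I`, then `N = P₀ + Σ_i w_i · U_i` with all coefficients of `P₀`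
in `I`. [folklore] -/
theorem exists_decomp_of_coeff_mem_span_sup {σ ι : Type*} [Fintype ι] [DecidableEq σ] (I : Ideal R) (w : ι → R)
    (N : MvPolynomial σ R) (h : ∀ α, N.coeff α ∈ Ideal.span (Set.range w) ⊔ I) :
    ∃ (P₀ : MvPolynomial σ R) (U : ι → MvPolynomial σ R), (∀ α, P₀.coeff α ∈ I) ∧ N = P₀ + ∑ i, C (w i) * U i := by
  classical
  have hdec : ∀ α, ∃ (cf : ι → R) (π : R), π ∈ I ∧ N.coeff α = (∑ i, cf i * w i) + π := by
    intro α
    obtain ⟨u, hu, π, hπ, hsum⟩ := Submodule.mem_sup.mp (h α)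
    obtain ⟨cf, hcf⟩ := Ideal.mem_span_range_iff_exists_fun.mp hu
    exact ⟨cf, π, hπ, by rw [hcf, hsum]⟩
  choose cf π hπ hNα using hdec
  refine ⟨∑ α ∈ N.support, monomial α (π α), fun i => ∑ α ∈ N.support, monomial α (cf α i), ?_, ?_⟩
  · intro β
    simp only [coeff_sum, coeff_monomial, Finset.sum_ite_eq']
    split_ifs
    · exact hπ β
    · exact I.zero_mem
  · ext β
    simp only [coeff_add, coeff_sum, coeff_C_mul, coeff_monomial, Finset.sum_ite_eq']
    by_cases hβ : β ∈ N.support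
    · simp only [if_pos hβ]
      rw [hNα β, add_comm]
      congr 1
      exact Finset.sum_congr rfl fun i _ => mul_comm _ _
    · simp only [if_neg hβ, mul_zero, Finset.sum_const_zero, add_zero]
      exact MvPolynomial.notMem_support_iff.mp hβ

end Poly

end Summit.ResolutionOfSingularities.ResolutionOfSingularities.Theorems.RadicialJung.CleanModels

end
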